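import Literature.Computability.FineGrained.SplitAndListOV
import Mathlib.Algebra.Order.Ring.GeomSum
import HarnessLib

/-!
# Williams' Orthogonal Vectors algorithm on the word RAM: the program and its build phase

Second ingredient of the proof of the win-win theorem `ethr2_lower_bound_or_ov_almost_linear` of
`Literature.Computability.FineGrained.Sweep1` (R. Williams, *The Orthogonal Vectors Conjecture
and Non-Uniform Circuit Lower Bounds*, FOCS 2024; full version ECCC TR24-142): the deterministic
algorithm of **Theorem 10** (fast evaluation of a low-rank equality representation on all pairs)
combined with the Kronecker-power representation of **Theorem 8** and run as in **Theorem 3**,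
written as structured word-RAM code (`SProg` of `…Cryptography.WordRAMStructured`, verified in the
logic `SProg.Achieves` of `…Cryptography.WordRAMAchieves`, with the conventions of
`…FineGrained.CliqueETHReductionProgram`: registers below `100`, data above, `merge` memories,
symbolic execution of straight-line blocks).

The machine part is stated for abstract compile-time `Tables` (block length `k`, `r` terms, key
base `Bd`, row/column tables `U ℓ c`, `V ℓ c` on block codes `c < 2^k`, coefficient magnitudes
and sign bits), so that it does not depend on the representation theory of
`…FineGrained.Sweep1EqualityRank`; the bridge to `EqRep.pairSum` is made in the file proving the
win-win theorem.

* **The algorithm** (`OVEq.prog tb`). Input: an `OV` instance `n :: d :: A ++ B` (`…SplitAndListOV`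
  for the encoding). With `K = ⌈d/k⌉` blocks: relocate the input; compute the bases (`setup`),
  `RK = r^K` (`rkLoop`); write the constant tables (`tables`); pack every row of both lists into `K`
  block codes (`codes`); then for every term `q < r^K` of the Kronecker power (`main`/`qBody`):
  the coefficient `β_q = ∏ α_{q_mb}` as magnitude and sign (`coef`); the key
  `Σ_mb U[q_mb][code_mb(a_i)] · Bd^mb` of every row of the first list, stored and *counted by
  direct addressing* in the zero-initialised memory above the data (`insert`, `keyLoop`); the
  number of equal key pairs `Σ_j H[key'_j]` (`count`); clearing the counting array at the stored
  keys (`reset`); `S⁺/S⁻ += |β_q| · count` (`accum`). Output `[1]` iff `S⁺ ≠ S⁻` (`output`).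
  Counting equal keys by direct addressing replaces the sorting of the paper's proof of Thm. 9/10
  (the word RAM has unit-cost access to a zero-initialised unbounded memory, and all keys are below
  `Bd^K`, polynomial in `n` in the regime `d = c log n`).
* **Ghost parameters and closed forms** (`OVEq.Params`: tables + instance): bases `X, TU, …, H0`,
  `K, RK, BK, CK`; the arithmetic of the run (`bitA/B`, `partCode`, `codeA/B`, `digit`, `keyA/B`,
  `mag`, `sgn`, `hcount`, `cnt`, `Spos`, `Sneg`, `outBit`); word-size requirements `Fits W`.
* **Verification of the build phase**: `setup_spec`, `rkLoop_spec`, `execOps_tabOps`/`tables_spec`,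
  `codeData_succ`, `codesBit_loop`, `codesRow_spec`, `codes_spec` (the data becomes `codeMem`:
  tables at `TU`, block codes at `BA`/`BB`, zero above). The main loop, the read-out and the run
  are verified in `…FineGrained.Sweep1OVMainLoop`.

## References

* R. Williams, *The Orthogonal Vectors Conjecture and Non-Uniform Circuit Lower Bounds*, FOCS 2024;
  ECCC TR24-142, §3, Thm. 8 (Uniformization), Thms. 9/10 (satisfying pairs), Thm. 3.
* T. Hagerup, *Sorting and searching on the word RAM*, STACS 1998, §2 (the machine model).
* T. Nipkow, G. Klein, *Concrete Semantics with Isabelle/HOL*, Springer 2014, §12 (verification of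
  `WHILE` programs by invariants).
-/

namespace Literature.Computability.FineGrained

open Cryptography Cryptography.WordRAM Complexity Cryptography.WordRAM.SProg

namespace OVEq

open CliqueRed (r pt im)

/-! ### The constant tables of the program -/

/-- The compile-time data of the OV program: block length `k`, number of terms `r`, key base
`Bd`, the row/column tables `U ℓ c`, `V ℓ c` (`ℓ < r`, `c < 2^k`) of the defining vectors on
block codes, and the magnitudes and sign bits of the coefficients. [folklore] -/
structure Tables where
  /-- Block length. -/
  k : ℕ
  /-- Number of terms of the representation. -/
  r : ℕ
  /-- Base of the packed keys (a strict bound on the table values). -/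
  Bd : ℕ
  /-- Row table: `U ℓ c = u^{(ℓ)}(c)`. -/
  U : ℕ → ℕ → ℕ
  /-- Column table: `V ℓ c = v^{(ℓ)}(c)`. -/
  V : ℕ → ℕ → ℕ
  /-- Coefficient magnitudes `|α_ℓ|`. -/
  cmag : ℕ → ℕ
  /-- Coefficient sign bits `[α_ℓ < 0]`. -/
  csgn : ℕ → ℕ
  /-- A bound on the coefficient magnitudes. -/
  cmax : ℕ

namespace Tables

variable (tb : Tables)

/-- Well-formed tables: positive block length, table values below the key base, sign bits, bounded
magnitudes. [folklore] -/
structure WF : Prop where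
  k_pos : 1 ≤ tb.k
  U_lt : ∀ ℓ c, tb.U ℓ c < tb.Bd
  V_lt : ∀ ℓ c, tb.V ℓ c < tb.Bd
  csgn_le : ∀ ℓ, tb.csgn ℓ ≤ 1
  cmag_le : ∀ ℓ, tb.cmag ℓ ≤ tb.cmax

/-- `2^k`, the number of block codes. [folklore] -/
def P : ℕ := 2 ^ tb.k

/-- The flat list of the four tables as laid out in memory: `U` (row-major, `r · 2^k` words),
`V`, `cmag` (`r` words), `csgn` (`r` words). [folklore] -/
def tableList : List ℕ :=
  ((List.range tb.r).flatMap fun ℓ => (List.range tb.P).map fun c => tb.U ℓ c) ++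
  ((List.range tb.r).flatMap fun ℓ => (List.range tb.P).map fun c => tb.V ℓ c) ++
  ((List.range tb.r).map tb.cmag) ++ ((List.range tb.r).map tb.csgn)

/-- The total table size `2 r 2^k + 2 r`. [folklore] -/
def tsz : ℕ := 2 * (tb.r * tb.P) + 2 * tb.r

/-- The table list has length `tsz`. [folklore] -/
theorem length_tableList : tb.tableList.length = tb.tsz := by
  simp [tableList, tsz, List.length_flatMap, P]; ring

/-- One table has `r · 2^k` words. [folklore] -/
theorem length_flatMap_table (F : ℕ → ℕ → ℕ) :
    ((List.range tb.r).flatMap fun ℓ => (List.range tb.P).map fun c => F ℓ c).length = tb.r * tb.P := by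
  simp [List.length_flatMap]

/-- Row-major indexing of one table. [folklore] -/
theorem getElem?_flatMap_table (F : ℕ → ℕ → ℕ) {ℓ c : ℕ} (hℓ : ℓ < tb.r) (hc : c < tb.P) :
    ((List.range tb.r).flatMap fun ℓ => (List.range tb.P).map fun c => F ℓ c)[ℓ * tb.P + c]? =
      some (F ℓ c) := by
  rw [getElem?_flatMap_const _ (List.range tb.r) (fun a _ => by simp) ℓ (by simpa using hℓ) c hc]
  simp [hc]

/-- Entry `(ℓ, c)` of the row table in the table list. [folklore] -/
theorem tableList_getD_U {ℓ c : ℕ} (hℓ : ℓ < tb.r) (hc : c < tb.P) :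
    tb.tableList.getD (ℓ * tb.P + c) 0 = tb.U ℓ c := by
  have hlt : ℓ * tb.P + c < tb.r * tb.P :=
    calc ℓ * tb.P + c < ℓ * tb.P + tb.P := by omega
      _ = (ℓ + 1) * tb.P := by ring
      _ ≤ tb.r * tb.P := Nat.mul_le_mul_right _ hℓ
  rw [List.getD_eq_getElem?_getD, tableList, List.append_assoc, List.append_assoc,
    List.getElem?_append_left (by rw [length_flatMap_table]; exact hlt),
    tb.getElem?_flatMap_table _ hℓ hc]
  rfl

/-- Entry `(ℓ, c)` of the column table in the table list. [folklore] -/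
theorem tableList_getD_V {ℓ c : ℕ} (hℓ : ℓ < tb.r) (hc : c < tb.P) :
    tb.tableList.getD (tb.r * tb.P + (ℓ * tb.P + c)) 0 = tb.V ℓ c := by
  have hlt : ℓ * tb.P + c < tb.r * tb.P :=
    calc ℓ * tb.P + c < ℓ * tb.P + tb.P := by omega
      _ = (ℓ + 1) * tb.P := by ring
      _ ≤ tb.r * tb.P := Nat.mul_le_mul_right _ hℓ
  rw [List.getD_eq_getElem?_getD, tableList, List.append_assoc, List.append_assoc,
    List.getElem?_append_right (by rw [length_flatMap_table]; omega), length_flatMap_table,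
    Nat.add_sub_cancel_left,
    List.getElem?_append_left (by rw [length_flatMap_table]; exact hlt),
    tb.getElem?_flatMap_table _ hℓ hc]
  rfl

/-- Entry `ℓ` of the magnitude table in the table list. [folklore] -/
theorem tableList_getD_cmag {ℓ : ℕ} (hℓ : ℓ < tb.r) :
    tb.tableList.getD (2 * (tb.r * tb.P) + ℓ) 0 = tb.cmag ℓ := by
  rw [List.getD_eq_getElem?_getD, tableList, List.append_assoc, List.append_assoc,
    List.getElem?_append_right (by rw [length_flatMap_table]; omega), length_flatMap_table,
    List.getElem?_append_right (by rw [length_flatMap_table]; omega), length_flatMap_table,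
    show 2 * (tb.r * tb.P) + ℓ - tb.r * tb.P - tb.r * tb.P = ℓ by omega,
    List.getElem?_append_left (by simpa using hℓ)]
  simp [hℓ]

/-- Entry `ℓ` of the sign table in the table list. [folklore] -/
theorem tableList_getD_csgn {ℓ : ℕ} (hℓ : ℓ < tb.r) :
    tb.tableList.getD (2 * (tb.r * tb.P) + tb.r + ℓ) 0 = tb.csgn ℓ := by
  rw [List.getD_eq_getElem?_getD, tableList, List.append_assoc, List.append_assoc,
    List.getElem?_append_right (by rw [length_flatMap_table]; omega), length_flatMap_table,
    List.getElem?_append_right (by rw [length_flatMap_table]; omega), length_flatMap_table,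
    List.getElem?_append_right (by simp; omega), List.length_map, List.length_range,
    show 2 * (tb.r * tb.P) + tb.r + ℓ - tb.r * tb.P - tb.r * tb.P - tb.r = ℓ by omega]
  simp [hℓ]


end Tables

/-! ### The program

Register map (cells `< 100`): `0 = X` (base of the relocated input), `1 = X - 1` (relocate);
`2 = n`, `3 = d`, `4 = K = ⌈d/k⌉`; bases `5 = BA`, `6 = BB` (block codes of the two lists),
`7 = TU`, `8 = TV`, `9 = TC`, `10 = TS` (tables), `11 = KA` (keys of the first list), `12 = H0`
(the counting array), `13 = RK = r^K`; `14` = outer counter, `15 = S⁺`, `16 = S⁻`, `17 = q`;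
`20–29` phase temporaries, `30–37` key-loop temporaries. -/

/-- Writing a constant list into memory through the pointer register `20`. [folklore] -/
def tabOps (l : List ℕ) : List OpSpec :=
  l.flatMap fun v => [(.add, pt 20, im v, im 0), (.add, r 20, r 20, im 1)]

/-- Setup: read `n, d`, compute `K` and all the bases, clear the accumulators. [folklore] -/
def setup (tb : Tables) : SProg := block [
  (.band, r 2, pt 0, pt 0),
  (.add, r 20, r 0, im 1), (.band, r 3, pt 20, pt 20),
  (.add, r 4, r 3, im (tb.k - 1)), (.div, r 4, r 4, im tb.k),
  (.add, r 7, r 0, r 0), (.sub, r 7, r 7, im 101),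
  (.add, r 8, r 7, im (tb.r * tb.P)), (.add, r 9, r 8, im (tb.r * tb.P)), (.add, r 10, r 9, im tb.r),
  (.add, r 5, r 10, im tb.r),
  (.mul, r 21, r 2, r 4), (.add, r 6, r 5, r 21), (.add, r 11, r 6, r 21), (.add, r 12, r 11, r 2),
  (.band, r 15, im 0, im 0), (.band, r 16, im 0, im 0), (.band, r 17, im 0, im 0),
  (.band, r 13, im 1, im 1), (.band, r 20, r 4, r 4)]

/-- `RK := r^K` by `K` multiplications. [folklore] -/
def rkLoop (tb : Tables) : SProg :=
  whilenz (r 20) (block [(.mul, r 13, r 13, im tb.r), (.sub, r 20, r 20, im 1)])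

/-- Write the four constant tables at `TU`. [folklore] -/
def tables (tb : Tables) : SProg := block ((.band, r 20, r 7, r 7) :: tabOps tb.tableList)

/-- Block codes, one bit `t = r27` of row `i`: add `bit << (t % k)` to code `t / k` of the row, for
both lists. [folklore] -/
def codesBit (tb : Tables) : SProg := block [
  (.div, r 28, r 27, im tb.k), (.mod, r 29, r 27, im tb.k),
  (.band, r 30, pt 22, pt 22), (.shl, r 30, r 30, r 29), (.add, r 31, r 24, r 28),
  (.add, pt 31, pt 31, r 30),
  (.band, r 30, pt 23, pt 23), (.shl, r 30, r 30, r 29), (.add, r 31, r 25, r 28),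
  (.add, pt 31, pt 31, r 30),
  (.add, r 22, r 22, im 1), (.add, r 23, r 23, im 1), (.add, r 27, r 27, im 1),
  (.sub, r 26, r 26, im 1)]

/-- Block codes, one row `i = r21` of both lists. [folklore] -/
def codesRow (tb : Tables) : SProg := seqs [
  block [(.band, r 26, r 3, r 3), (.band, r 27, im 0, im 0)],
  whilenz (r 26) (codesBit tb),
  block [(.add, r 24, r 24, r 4), (.add, r 25, r 25, r 4), (.add, r 21, r 21, im 1),
    (.sub, r 20, r 20, im 1)]]

/-- Block codes of all rows of both lists. [folklore] -/
def codes (tb : Tables) : SProg := seqs [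
  block [(.band, r 20, r 2, r 2), (.band, r 21, im 0, im 0), (.add, r 22, r 0, im 2),
    (.mul, r 23, r 2, r 3), (.add, r 23, r 23, r 22), (.band, r 24, r 5, r 5),
    (.band, r 25, r 6, r 6)],
  whilenz (r 20) (codesRow tb)]

/-- Coefficient loop body: digit `mb` of `q`, multiply the magnitude, xor the sign. [folklore] -/
def coefBody (tb : Tables) : SProg := block [
  (.div, r 24, r 17, r 21), (.mod, r 24, r 24, im tb.r),
  (.add, r 25, r 9, r 24), (.mul, r 22, r 22, pt 25),
  (.add, r 25, r 10, r 24), (.bxor, r 23, r 23, pt 25),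
  (.mul, r 21, r 21, im tb.r), (.sub, r 20, r 20, im 1)]

/-- The coefficient of term `q`: magnitude `r22`, sign bit `r23`. [folklore] -/
def coef (tb : Tables) : SProg := seqs [
  block [(.band, r 20, r 4, r 4), (.band, r 21, im 1, im 1), (.band, r 22, im 1, im 1),
    (.band, r 23, im 0, im 0)],
  whilenz (r 20) (coefBody tb)]

/-- Key loop body (table base register `t`): add `T[digit_mb(q)][code_mb] · Bd^mb` to the key
`r33`. [folklore] -/
def keyBody (tb : Tables) (t : ℕ) : SProg := block [
  (.div, r 35, r 17, r 31), (.mod, r 35, r 35, im tb.r), (.mul, r 36, r 35, im tb.P),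
  (.add, r 36, r 36, pt 34), (.add, r 36, r t, r 36), (.band, r 37, pt 36, pt 36),
  (.mul, r 37, r 37, r 32), (.add, r 33, r 33, r 37),
  (.mul, r 31, r 31, im tb.r), (.mul, r 32, r 32, im tb.Bd), (.add, r 34, r 34, im 1),
  (.sub, r 30, r 30, im 1)]

/-- The key of the row whose block codes start at `r26`, for term `q = r17`, with the table whose
base is register `t`; result in `r33`, `r34 = r26 + K`. [folklore] -/
def keyLoop (tb : Tables) (t : ℕ) : SProg := seqs [
  block [(.band, r 30, r 4, r 4), (.band, r 31, im 1, im 1), (.band, r 32, im 1, im 1),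
    (.band, r 33, im 0, im 0), (.band, r 34, r 26, r 26)],
  whilenz (r 30) (keyBody tb t)]

/-- Insert loop body: the key of row `i` of the first list, stored at `KA + i` and counted in the
counting array. [folklore] -/
def insBody (tb : Tables) : SProg := seqs [
  keyLoop tb 7,
  block [(.band, pt 27, r 33, r 33), (.add, r 36, r 12, r 33), (.add, pt 36, pt 36, im 1),
    (.band, r 26, r 34, r 34), (.add, r 27, r 27, im 1), (.sub, r 20, r 20, im 1)]]

/-- The insert loop over the rows of the first list. [folklore] -/
def insert (tb : Tables) : SProg := seqs [
  block [(.band, r 20, r 2, r 2), (.band, r 26, r 5, r 5), (.band, r 27, r 11, r 11)],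
  whilenz (r 20) (insBody tb)]

/-- Count loop body: the key of row `j` of the second list, looked up in the counting array and
added to `r28`. [folklore] -/
def cntBody (tb : Tables) : SProg := seqs [
  keyLoop tb 8,
  block [(.add, r 36, r 12, r 33), (.add, r 28, r 28, pt 36), (.band, r 26, r 34, r 34),
    (.sub, r 20, r 20, im 1)]]

/-- The count loop over the rows of the second list: `r28 := #{(i, j) : key_i = key'_j}`.
[folklore] -/
def count (tb : Tables) : SProg := seqs [
  block [(.band, r 28, im 0, im 0), (.band, r 20, r 2, r 2), (.band, r 26, r 6, r 6)],
  whilenz (r 20) (cntBody tb)]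

/-- Reset loop body: clear the counting array at the key of row `i`. [folklore] -/
def rstBody : SProg := block [
  (.add, r 36, r 12, pt 27), (.band, pt 36, im 0, im 0), (.add, r 27, r 27, im 1),
  (.sub, r 20, r 20, im 1)]

/-- The reset loop: the counting array returns to zero. [folklore] -/
def reset : SProg := seqs [
  block [(.band, r 20, r 2, r 2), (.band, r 27, r 11, r 11)],
  whilenz (r 20) rstBody]

/-- Accumulate `|β_q| · count` into `S⁺` or `S⁻` according to the sign of `β_q`. [folklore] -/
def accum : SProg := seqs [
  block [(.mul, r 24, r 22, r 28)],
  ifz (r 23) (block [(.add, r 15, r 15, r 24)]) (block [(.add, r 16, r 16, r 24)])]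

/-- One term `q` of the Kronecker power. [folklore] -/
def qBody (tb : Tables) : SProg := seqs [
  coef tb, insert tb, count tb, reset, accum,
  block [(.add, r 17, r 17, im 1), (.sub, r 14, r 14, im 1)]]

/-- The main loop over the `r^K` terms. [folklore] -/
def main (tb : Tables) : SProg := seqs [
  block [(.band, r 14, r 13, r 13)],
  whilenz (r 14) (qBody tb)]

/-- The read-out: output `[1]` iff `S⁺ ≠ S⁻`. [folklore] -/
def output : SProg := block [
  (.eq, r 20, r 15, r 16), (.sub, r 21, im 1, r 20), (.band, r 1, r 21, r 21),
  (.band, r 0, im 1, im 1)]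

/-- **The OV program** of Williams (ECCC TR24-142, Thms. 8, 10 and 3), with the equal-key counts
done by direct addressing. [cite: Williams2024, Thm. 10] -/
def prog (tb : Tables) : SProg := seqs [
  relocate, setup tb, rkLoop tb, tables tb, codes tb, main tb, output]

/-- The program is query-free. [folklore] -/
theorem prog_queryFree (tb : Tables) : (prog tb).QueryFree := by
  refine seqs_queryFree ?_
  simp only [List.mem_cons, List.not_mem_nil, or_false]
  rintro s (rfl | rfl | rfl | rfl | rfl | rfl | rfl)
  · exact relocate_queryFree
  · exact block_queryFree _
  · exact block_queryFree _
  · exact block_queryFree _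
  · simp [codes, codesRow, codesBit, seqs, QueryFree, block_queryFree]
  · simp [main, qBody, coef, coefBody, insert, insBody, keyLoop, keyBody, count, cntBody, reset,
      rstBody, accum, seqs, QueryFree, block_queryFree]
  · exact block_queryFree _


/-! ### Block codes -/

section partCode

open Finset

/-- The code of block `mb` accumulated from the bits `t' < t`: `Σ_{t' < t, t'/k = mb} bit t' 2^{t' % k}`
(the bits of a row are packed `k` at a time). [folklore] -/
def partCode (bit : ℕ → ℕ) (k t mb : ℕ) : ℕ :=
  ∑ t' ∈ (range t).filter (fun t' => t' / k = mb), bit t' * 2 ^ (t' % k)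

/-- No bits, no code. [folklore] -/
theorem partCode_zero (bit : ℕ → ℕ) (k mb : ℕ) : partCode bit k 0 mb = 0 := by
  simp [partCode]

/-- One more bit. [folklore] -/
theorem partCode_succ (bit : ℕ → ℕ) (k t mb : ℕ) :
    partCode bit k (t + 1) mb = partCode bit k t mb + if t / k = mb then bit t * 2 ^ (t % k) else 0 := by
  unfold partCode
  rw [Finset.range_add_one, Finset.filter_insert]
  split_ifs with h
  · rw [Finset.sum_insert (by simp), Nat.add_comm]
  · rw [Nat.add_zero]

/-- Block codes are below `2^k` (the positions `t' % k` of the bits of one block are distinct).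
[folklore] -/
theorem partCode_lt {bit : ℕ → ℕ} (hbit : ∀ t, bit t ≤ 1) {k : ℕ} (hk : 0 < k) (t mb : ℕ) :
    partCode bit k t mb < 2 ^ k := by
  unfold partCode
  set S := (range t).filter (fun t' => t' / k = mb) with hS
  have hinj : Set.InjOn (fun t' => t' % k) S := by
    intro a ha b hb hab
    simp only [hS, coe_filter, Set.mem_setOf_eq, mem_range] at ha hb
    simp only at hab
    rw [← Nat.div_add_mod a k, ← Nat.div_add_mod b k, ha.2, hb.2, hab]
  calc ∑ t' ∈ S, bit t' * 2 ^ (t' % k) ≤ ∑ t' ∈ S, 2 ^ (t' % k) :=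
        Finset.sum_le_sum fun t' _ => by
          have := hbit t'; calc bit t' * 2 ^ (t' % k) ≤ 1 * 2 ^ (t' % k) := by gcongr
            _ = _ := Nat.one_mul _
    _ = ∑ e ∈ S.image (fun t' => t' % k), 2 ^ e := (Finset.sum_image hinj).symm
    _ < 2 ^ k := Nat.geomSum_lt le_rfl fun e he => by
        simp only [mem_image] at he
        obtain ⟨t', -, rfl⟩ := he
        exact Nat.mod_lt _ hk

end partCode

/-! ### Ghost parameters of a run -/

/-- The data of a run: the tables and the OV instance. [folklore] -/
structure Params where
  /-- The compile-time tables. -/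
  tb : Tables
  /-- The input instance. -/
  I : OVInstance

namespace Params

open Finset

variable (g : Params)

/-- Number of vectors per list. [folklore] -/
def n : ℕ := g.I.n
/-- Dimension. [folklore] -/
def d : ℕ := g.I.d
/-- The input words. [folklore] -/
def x : List ℕ := OVInstance.encode g.I
/-- The input words are the `OV` encoding. [folklore] -/
theorem OV_encode_eq_x : OV.encode g.I = g.x := rfl
/-- The input length `L = 2 + 2 n d`. [folklore] -/
def L : ℕ := g.x.length
/-- The base of the relocated input: `x[j]` sits in cell `X + j`. [folklore] -/
def X : ℕ := g.L + 101
/-- The number of blocks `K = ⌈d / k⌉`. [folklore] -/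
def K : ℕ := (g.d + (g.tb.k - 1)) / g.tb.k
/-- Base of the row table `U`. [folklore] -/
def TU : ℕ := g.X + g.L
/-- Base of the column table `V`. [folklore] -/
def TV : ℕ := g.TU + g.tb.r * g.tb.P
/-- Base of the magnitude table. [folklore] -/
def TC : ℕ := g.TV + g.tb.r * g.tb.P
/-- Base of the sign table. [folklore] -/
def TS : ℕ := g.TC + g.tb.r
/-- Base of the block codes of the first list. [folklore] -/
def BA : ℕ := g.TS + g.tb.r
/-- Base of the block codes of the second list. [folklore] -/
def BB : ℕ := g.BA + g.n * g.K
/-- Base of the key array of the first list. [folklore] -/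
def KA : ℕ := g.BB + g.n * g.K
/-- Base of the counting array. [folklore] -/
def H0 : ℕ := g.KA + g.n
/-- The number of terms of the Kronecker power, `RK = r^K`. [folklore] -/
def RK : ℕ := g.tb.r ^ g.K
/-- The key bound `BK = Bd^K`. [folklore] -/
def BK : ℕ := g.tb.Bd ^ g.K
/-- The magnitude bound `CK = cmax^K`. [folklore] -/
def CK : ℕ := g.tb.cmax ^ g.K

/-- The chain of bases. [folklore] -/
theorem bases : 100 < g.X ∧ g.X + g.L = g.TU ∧ g.TU + g.tb.r * g.tb.P = g.TV ∧
    g.TV + g.tb.r * g.tb.P = g.TC ∧ g.TC + g.tb.r = g.TS ∧ g.TS + g.tb.r = g.BA ∧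
    g.BA + g.n * g.K = g.BB ∧ g.BB + g.n * g.K = g.KA ∧ g.KA + g.n = g.H0 := by
  refine ⟨by unfold X; omega, rfl, rfl, rfl, rfl, rfl, rfl, rfl, rfl⟩

/-- `L = 2 + 2 n d`. [folklore] -/
theorem L_eq : g.L = 2 + 2 * (g.n * g.d) := length_OV_encode g.I

/-- The tables occupy `[TU, BA)`: `BA = TU + tsz`. [folklore] -/
theorem BA_eq : g.BA = g.TU + g.tb.tsz := by
  unfold BA TS TC TV Tables.tsz; ring

/-! ### The arithmetic of the algorithm in closed form -/

/-- Bit `t` of row `i` of the first list (`0` out of range). [folklore] -/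
def bitA (i t : ℕ) : ℕ := if h : i < g.n ∧ t < g.d then (g.I.A ⟨i, h.1⟩ ⟨t, h.2⟩).toNat else 0
/-- Bit `t` of row `j` of the second list (`0` out of range). [folklore] -/
def bitB (j t : ℕ) : ℕ := if h : j < g.n ∧ t < g.d then (g.I.B ⟨j, h.1⟩ ⟨t, h.2⟩).toNat else 0

/-- Block code `mb` of row `i` of the first list. [folklore] -/
def codeA (i mb : ℕ) : ℕ := partCode (g.bitA i) g.tb.k g.d mb
/-- Block code `mb` of row `j` of the second list. [folklore] -/
def codeB (j mb : ℕ) : ℕ := partCode (g.bitB j) g.tb.k g.d mb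

/-- Digit `mb` of the term index `q` in base `r`: the index `q_mb` of the `mb`-th factor.
[folklore] -/
def digit (q mb : ℕ) : ℕ := q / g.tb.r ^ mb % g.tb.r

/-- The key of row `i` of the first list for term `q`, over the first `M` blocks:
`Σ_{mb < M} U[q_mb][code_mb] · Bd^mb`. [folklore] -/
def keyA (q i M : ℕ) : ℕ := ∑ mb ∈ range M, g.tb.U (g.digit q mb) (g.codeA i mb) * g.tb.Bd ^ mb
/-- The key of row `j` of the second list for term `q`, over the first `M` blocks. [folklore] -/
def keyB (q j M : ℕ) : ℕ := ∑ mb ∈ range M, g.tb.V (g.digit q mb) (g.codeB j mb) * g.tb.Bd ^ mb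

/-- The magnitude `∏_{mb < M} |α_{q_mb}|` of the coefficient of term `q`. [folklore] -/
def mag (q M : ℕ) : ℕ := ∏ mb ∈ range M, g.tb.cmag (g.digit q mb)
/-- The sign bit of the coefficient of term `q`: the parity of the negative factors. [folklore] -/
def sgn (q M : ℕ) : ℕ := (∑ mb ∈ range M, g.tb.csgn (g.digit q mb)) % 2

/-- The counting array: the number of rows `i < p` of the first list with key `v`. [folklore] -/
def hcount (q p v : ℕ) : ℕ := ((range p).filter fun i => g.keyA q i g.K = v).card
/-- The count of equal key pairs `(i, j)` with `i < n`, `j < p`. [folklore] -/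
def cnt (q p : ℕ) : ℕ := ∑ j ∈ range p, g.hcount q g.n (g.keyB q j g.K)

/-- The positive part `S⁺` of the pair sum over the terms `q < Q`. [folklore] -/
def Spos (Q : ℕ) : ℕ := ∑ q ∈ (range Q).filter (fun q => g.sgn q g.K = 0), g.mag q g.K * g.cnt q g.n
/-- The negative part `S⁻` of the pair sum over the terms `q < Q`. [folklore] -/
def Sneg (Q : ℕ) : ℕ := ∑ q ∈ (range Q).filter (fun q => g.sgn q g.K ≠ 0), g.mag q g.K * g.cnt q g.n

/-- The output bit: `1` iff `S⁺ ≠ S⁻`. [folklore] -/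
def outBit : ℕ := if g.Spos g.RK = g.Sneg g.RK then 0 else 1

/-! ### Word-size requirements -/

/-- **Word-size requirements** of a run at word size `W`. [folklore] -/
structure Fits (W : ℕ) : Prop where
  width : inputWidth g.x ≤ W
  top : g.H0 + g.BK + 1 ≤ 2 ^ W
  xx : 2 * g.X + 2 ≤ 2 ^ W
  dk : g.d + g.tb.k ≤ 2 ^ W
  rk : g.RK + 1 ≤ 2 ^ W
  bd : g.tb.Bd + g.tb.P + g.tb.cmax ≤ 2 ^ W
  prod : g.RK * g.CK * (g.n * g.n + 1) + g.CK + 1 ≤ 2 ^ W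
  nn : g.n * g.n + g.n + 1 ≤ 2 ^ W

/-- Under `Fits`, the input words fit. [folklore] -/
theorem Fits.input {g : Params} {W : ℕ} (h : g.Fits W) : ∀ v ∈ g.x, v < 2 ^ W := fun v hv =>
  lt_of_lt_of_le (lt_two_pow_inputWidth_of_mem g.x v hv) (Nat.pow_le_pow_right Nat.two_pos h.width)


/-! ### Register conventions -/

/-- The base registers, constant after the setup: `X, n, d, K` and the bases. [folklore] -/
structure Regs (m : ℕ → ℕ) : Prop where
  r0 : m 0 = g.X
  r2 : m 2 = g.n
  r3 : m 3 = g.d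
  r4 : m 4 = g.K
  r5 : m 5 = g.BA
  r6 : m 6 = g.BB
  r7 : m 7 = g.TU
  r8 : m 8 = g.TV
  r9 : m 9 = g.TC
  r10 : m 10 = g.TS
  r11 : m 11 = g.KA
  r12 : m 12 = g.H0

variable {g}

/-- `Regs` survives changes above register `12`. [folklore] -/
theorem Regs.of_frame {m m' : ℕ → ℕ} (h : g.Regs m) (hf : ∀ a, a ≤ 12 → m' a = m a) : g.Regs m' :=
  ⟨(hf 0 (by omega)).trans h.r0, (hf 2 (by omega)).trans h.r2, (hf 3 (by omega)).trans h.r3,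
    (hf 4 (by omega)).trans h.r4, (hf 5 (by omega)).trans h.r5, (hf 6 (by omega)).trans h.r6,
    (hf 7 (by omega)).trans h.r7, (hf 8 (by omega)).trans h.r8, (hf 9 (by omega)).trans h.r9,
    (hf 10 (by omega)).trans h.r10, (hf 11 (by omega)).trans h.r11, (hf 12 (by omega)).trans h.r12⟩

variable (g)

/-! ### Reading the relocated input -/

/-- `2 ≤ L`. [folklore] -/
theorem two_le_L : 2 ≤ g.L := by rw [g.L_eq]; omega

/-- Cell `0` after relocation holds `X`. [folklore] -/
@[simp] theorem relocated_zero' : relocated g.x 0 = g.X := by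
  rw [relocated_zero]; rfl

/-- Cell `1` after relocation holds `X - 1`. [folklore] -/
@[simp] theorem relocated_one' : relocated g.x 1 = g.X - 1 := by
  rw [relocated_one]; unfold X L; omega

/-- The relocated input: `x[j]` sits in cell `X + j` (and `0` past the input). [folklore] -/
theorem relocated_X_add (j : ℕ) : relocated g.x (g.X + j) = g.x.getD j 0 := by
  by_cases hj : j < g.L
  · have := relocated_base_add g.x (i := j + 1) (by omega) (by unfold L at hj; omega)
    rw [show g.x.length + 100 + (j + 1) = g.X + j by unfold X L; omega] at this
    rw [this]; rfl
  · rw [relocated_of_lt g.x (by unfold X L at *; omega),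
      List.getD_eq_default _ _ (by unfold L at hj; omega)]

/-- Everything from `TU` on is `0` after relocation. [folklore] -/
theorem relocated_of_TU_le {a : ℕ} (ha : g.TU ≤ a) : relocated g.x a = 0 :=
  relocated_of_lt g.x (by unfold TU X L at ha; omega)

/-- Word `0` of the input is `n`. [folklore] -/
theorem x_getD_zero : g.x.getD 0 0 = g.n := rfl

/-- Word `1` of the input is `d`. [folklore] -/
theorem x_getD_one : g.x.getD 1 0 = g.d := rfl

/-- Word `2 + (i d + t)` of the input is the bit `A i t`. [folklore] -/
theorem x_getD_A {i t : ℕ} (hi : i < g.n) (ht : t < g.d) :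
    g.x.getD (2 + (i * g.d + t)) 0 = g.bitA i t := by
  have := OV_encode_getElem?_A g.I ⟨i, hi⟩ ⟨t, ht⟩
  rw [g.OV_encode_eq_x] at this
  rw [List.getD_eq_getElem?_getD, show g.d = g.I.d from rfl, this]
  unfold bitA; rw [dif_pos ⟨hi, ht⟩]; rfl

/-- Word `2 + (n d + (j d + t))` of the input is the bit `B j t`. [folklore] -/
theorem x_getD_B {j t : ℕ} (hj : j < g.n) (ht : t < g.d) :
    g.x.getD (2 + (g.n * g.d + (j * g.d + t))) 0 = g.bitB j t := by
  have := OV_encode_getElem?_B g.I ⟨j, hj⟩ ⟨t, ht⟩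
  rw [g.OV_encode_eq_x] at this
  rw [List.getD_eq_getElem?_getD, show g.d = g.I.d from rfl, show g.n = g.I.n from rfl, this]
  unfold bitB; rw [dif_pos ⟨hj, ht⟩]; rfl

/-- `1 ≤ Bd` for well-formed tables with `r ≥ 1`; in general `U ℓ c < Bd` forces it whenever
used. We record the unconditional `BK ≥ 1 ∨ …` facts we need through `Fits`. [folklore] -/
theorem one_le_P : 1 ≤ g.tb.P := Nat.one_le_two_pow

/-- The standard linear facts about the ghost parameters under `Fits`. [folklore] -/
theorem facts {W : ℕ} (hF : g.Fits W) :
    100 < g.X ∧ g.X = g.L + 101 ∧ g.X + g.L = g.TU ∧ g.TU + g.tb.r * g.tb.P = g.TV ∧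
    g.TV + g.tb.r * g.tb.P = g.TC ∧ g.TC + g.tb.r = g.TS ∧ g.TS + g.tb.r = g.BA ∧
    g.BA + g.n * g.K = g.BB ∧ g.BB + g.n * g.K = g.KA ∧ g.KA + g.n = g.H0 ∧
    g.H0 + g.BK + 1 ≤ 2 ^ W ∧ 2 * g.X + 2 ≤ 2 ^ W ∧ g.d + g.tb.k ≤ 2 ^ W ∧ g.RK + 1 ≤ 2 ^ W ∧
    g.tb.Bd + g.tb.P + g.tb.cmax ≤ 2 ^ W ∧ g.RK * g.CK * (g.n * g.n + 1) + g.CK + 1 ≤ 2 ^ W ∧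
    g.L = 2 + 2 * (g.n * g.d) ∧ 1 ≤ g.tb.P ∧ g.n * g.n + g.n + 1 ≤ 2 ^ W := by
  obtain ⟨h1, h2, h3, h4, h5, h6, h7, h8, h9⟩ := g.bases
  exact ⟨h1, rfl, h2, h3, h4, h5, h6, h7, h8, h9, hF.top, hF.xx, hF.dk, hF.rk, hF.bd, hF.prod,
    g.L_eq, g.one_le_P, hF.nn⟩

/-! ### The setup phase -/

variable {W : ℕ} {O : List ℕ → List ℕ}

/-- **Setup.** From the relocated memory, `setup` computes the base registers, sets
`r13 := 1`, `r20 := K`, clears `S⁺, S⁻, q`, and does not touch the data. [folklore] -/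
theorem setup_spec (hF : g.Fits W) (hk : 1 ≤ g.tb.k) :
    Achieves W O (setup g.tb) (relocated g.x)
      (fun m => g.Regs m ∧ m 1 = g.X - 1 ∧ m 13 = 1 ∧ m 20 = g.K ∧ m 15 = 0 ∧ m 16 = 0 ∧
        m 17 = 0 ∧ ∀ a, 100 ≤ a → m a = relocated g.x a) 20 := by
  obtain ⟨hX, hXL, hTU, hTV, hTC, hTS, hBA, hBB, hKA, hH0, htop, hxx, hdk, hrk, hbd, hprod, hL,
    hP, hnn⟩ := g.facts hF
  have hreadn : relocated g.x g.X = g.n := by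
    have := g.relocated_X_add 0; rw [Nat.add_zero] at this; rw [this, x_getD_zero]
  have hreadd : relocated g.x (g.X + 1) = g.d := by rw [relocated_X_add, x_getD_one]
  have hKdef : (g.d + (g.tb.k - 1)) / g.tb.k = g.K := rfl
  have hTU' : g.X + g.X - 101 = g.TU := by omega
  have hnK : g.n * g.K ≤ g.H0 := by omega
  have hdk1 : g.d + (g.tb.k - 1) < 2 ^ W := by omega
  unfold setup
  refine CliqueRed.achieves_block_of_eq (fun m' hm' => ?_) (by simp)
  simp (disch := first | omega | decide) only [execOps_cons, execOps_nil, execOp,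
    Operand.write, Operand.read, merge_apply_of_lt, merge_apply_of_le, update_merge_of_lt,
    Function.update_self, Function.update_of_ne, BinOp.eval_add_of_lt, BinOp.eval_sub_of_le,
    BinOp.eval_mul_of_lt, BinOp.eval_div, BinOp.eval_band, Nat.and_self,
    relocated_zero', hreadn, hreadd, hKdef, hTU'] at hm'
  subst hm'
  refine ⟨⟨?_, ?_, ?_, ?_, ?_, ?_, ?_, ?_, ?_, ?_, ?_, ?_⟩, ?_, ?_, ?_, ?_, ?_, ?_, fun a ha => ?_⟩
  all_goals (try simp (disch := first | omega | decide) only [merge_apply_of_lt,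
    merge_apply_of_le, Function.update_self, Function.update_of_ne])
  all_goals (try simp only [relocated_zero', relocated_one'])
  all_goals omega


/-- Powers of `r` up to `K` fit. [folklore] -/
theorem pow_r_lt (hF : g.Fits W) {i : ℕ} (hi : i ≤ g.K) : g.tb.r ^ i < 2 ^ W := by
  have hrk := hF.rk
  have hW : 1 ≤ W := le_trans (inputWidth_pos _) hF.width
  rcases Nat.eq_zero_or_pos g.tb.r with h0 | hpos
  · rw [h0]; rcases Nat.eq_zero_or_pos i with rfl | hi0
    · simp only [pow_zero]; exact Nat.one_lt_two_pow (by omega)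
    · rw [zero_pow (by omega)]; exact Nat.two_pow_pos W
  · have : g.tb.r ^ i ≤ g.RK := Nat.pow_le_pow_right hpos hi
    omega

/-- `K ≤ d` (for `k ≥ 1`). [folklore] -/
theorem K_le_d (hk : 1 ≤ g.tb.k) : g.K ≤ g.d := by
  have h1 : g.K * g.tb.k ≤ g.d + (g.tb.k - 1) := Nat.div_mul_le_self _ _
  have h2 : g.K ≤ g.K * g.tb.k := Nat.le_mul_of_pos_right _ hk
  by_contra h
  push Not at h
  have h3 : (g.d + 1) * g.tb.k ≤ g.K * g.tb.k := Nat.mul_le_mul_right _ h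
  have h4 : g.d ≤ g.d * g.tb.k := Nat.le_mul_of_pos_right _ hk
  rw [Nat.add_mul, Nat.one_mul] at h3
  omega

/-- **The `RK` loop**: `r13 := r^K`, `r20 := 0`, nothing else changes, within `4 K + 1` steps.
[folklore] -/
theorem rkLoop_spec (hF : g.Fits W) (hk : 1 ≤ g.tb.k) {m : ℕ → ℕ} (h13 : m 13 = 1)
    (h20 : m 20 = g.K) :
    Achieves W O (rkLoop g.tb) m
      (fun m' => m' 13 = g.RK ∧ m' 20 = 0 ∧ ∀ a, a ≠ 13 → a ≠ 20 → m' a = m a) (g.K * 4 + 1) := by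
  refine Achieves.whilenz g.K 2
    (fun i m' => m' 13 = g.tb.r ^ i ∧ m' 20 = g.K - i ∧ ∀ a, a ≠ 13 → a ≠ 20 → m' a = m a)
    (fun i hi m' ⟨h1, h2, h3⟩ => ⟨?_, ?_⟩) (fun m' ⟨_, h2, _⟩ => ?_) ⟨by simpa using h13, by simpa using h20,
    fun a _ _ => rfl⟩ (fun m' ⟨h1, h2, h3⟩ => ⟨h1, by simpa using h2, h3⟩) le_rfl
  · simp only [Operand.read, h2]; omega
  · have hpow : g.tb.r ^ i * g.tb.r < 2 ^ W := by
      rw [← pow_succ]; exact g.pow_r_lt hF (by omega)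
    have hKW : g.K - i < 2 ^ W := by have := g.K_le_d hk; have := hF.dk; omega
    refine CliqueRed.achieves_block_of_eq (fun m'' hm'' => ?_) le_rfl
    simp (disch := first | omega | decide) only [execOps_cons, execOps_nil, execOp, Operand.write,
      Operand.read, merge_apply_of_lt, update_merge_of_lt, Function.update_of_ne,
      BinOp.eval_mul_of_lt, BinOp.eval_sub_of_le, h1, h2] at hm''
    subst hm''
    refine ⟨?_, ?_, fun a ha1 ha2 => ?_⟩
    · simp (disch := first | omega | decide) only [merge_apply_of_lt, Function.update_self,
        Function.update_of_ne, pow_succ]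
    · simp (disch := first | omega | decide) only [merge_apply_of_lt, Function.update_self]
      omega
    · by_cases ha : a < 100
      · rw [merge_apply_of_lt ha, Function.update_of_ne ha2, Function.update_of_ne ha1,
          h3 a ha1 ha2]
      · rw [merge_apply_of_le (by omega), h3 a ha1 ha2]
  · simp only [Operand.read, h2]; omega

/-! ### The constant tables -/

/-- Writing a list at `p`: the data memory afterwards. [folklore] -/
def writeList (H : ℕ → ℕ) (p : ℕ) (l : List ℕ) : ℕ → ℕ := fun a =>
  if p ≤ a ∧ a < p + l.length then l.getD (a - p) 0 else H a

/-- One more word written in front. [folklore] -/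
theorem writeList_cons (H : ℕ → ℕ) (p v : ℕ) (l : List ℕ) :
    writeList (Function.update H p v) (p + 1) l = writeList H p (v :: l) := by
  funext a
  unfold writeList
  by_cases h1 : p + 1 ≤ a ∧ a < p + 1 + l.length
  · rw [if_pos h1, if_pos ⟨by omega, by simp; omega⟩,
      show a - p = (a - (p + 1)) + 1 by omega, List.getD_cons_succ]
  · rw [if_neg h1]
    by_cases h2 : a = p
    · subst h2; rw [Function.update_self, if_pos ⟨le_rfl, by simp⟩, Nat.sub_self, List.getD_cons_zero]
    · rw [Function.update_of_ne h2, if_neg (by simp; omega)]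

/-- **Symbolic execution of `tabOps`**: writing the list `l` through the pointer register `20`
(pointing at `p ≥ 100`) stores `l` at `p, p + 1, …` and advances the pointer by `|l|`. [folklore] -/
theorem execOps_tabOps (l : List ℕ) : ∀ (S H : ℕ → ℕ) (p : ℕ), S 20 = p → 100 ≤ p →
    p + l.length < 2 ^ W → (∀ v ∈ l, v < 2 ^ W) →
    execOps W (merge S H) (tabOps l) =
      merge (Function.update S 20 (p + l.length)) (writeList H p l) := by
  induction l with
  | nil =>
    intro S H p hp _ _ _
    simp only [tabOps, List.flatMap_nil, execOps_nil, List.length_nil, Nat.add_zero]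
    rw [← hp, Function.update_eq_self]
    congr 1
    funext a; simp [writeList]
  | cons v l ih =>
    intro S H p hp h100 hlen hv
    have hv0 : v < 2 ^ W := hv v (by simp)
    have hlen' : p + l.length + 1 < 2 ^ W := by simp at hlen; omega
    simp only [tabOps, List.flatMap_cons] at ih ⊢
    rw [show ([(BinOp.add, pt 20, im v, im 0), (BinOp.add, r 20, r 20, im 1)] ++
        List.flatMap (fun v => [(BinOp.add, pt 20, im v, im 0), (BinOp.add, r 20, r 20, im 1)]) l)
        = (BinOp.add, pt 20, im v, im 0) :: (BinOp.add, r 20, r 20, im 1) ::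
          List.flatMap (fun v => [(BinOp.add, pt 20, im v, im 0), (BinOp.add, r 20, r 20, im 1)]) l
        from rfl]
    rw [execOps_cons, execOps_cons]
    have e1 : execOp W (merge S H) (BinOp.add, pt 20, im v, im 0) =
        merge S (Function.update H p v) := by
      simp (disch := first | omega | decide) only [execOp, Operand.write, Operand.read,
        merge_apply_of_lt, hp, update_merge_of_le, BinOp.eval_add_of_lt, Nat.add_zero]
    have e2 : execOp W (merge S (Function.update H p v)) (BinOp.add, r 20, r 20, im 1) =
        merge (Function.update S 20 (p + 1)) (Function.update H p v) := by
      simp (disch := first | omega | decide) only [execOp, Operand.write, Operand.read,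
        merge_apply_of_lt, hp, update_merge_of_lt, BinOp.eval_add_of_lt]
    rw [e1, e2, ih (Function.update S 20 (p + 1)) (Function.update H p v) (p + 1)
      (Function.update_self ..) (by omega) (by omega)
      (fun w hw => hv w (by simp [hw]))]
    rw [Function.update_idem, writeList_cons]
    congr 2
    simp; omega


/-- `tabOps` has two operations per word. [folklore] -/
@[simp] theorem length_tabOps (l : List ℕ) : (tabOps l).length = 2 * l.length := by
  induction l with
  | nil => rfl
  | cons v l ih => simp only [tabOps, List.flatMap_cons, List.length_append, List.length_cons,
      List.length_nil] at ih ⊢; omega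

/-- The words of the table list are table values, hence small. [folklore] -/
theorem tableList_lt (htb : g.tb.WF) {v : ℕ} (hv : v ∈ g.tb.tableList) :
    v ≤ g.tb.Bd + g.tb.cmax := by
  simp only [Tables.tableList, List.mem_append, List.mem_flatMap, List.mem_map, List.mem_range]
    at hv
  rcases hv with ((⟨ℓ, -, c, -, rfl⟩ | ⟨ℓ, -, c, -, rfl⟩) | ⟨ℓ, -, rfl⟩) | ⟨ℓ, -, rfl⟩
  · have := htb.U_lt ℓ c; omega
  · have := htb.V_lt ℓ c; omega
  · have := htb.cmag_le ℓ; omega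
  · have := htb.csgn_le ℓ; have := htb.U_lt ℓ 0; omega

/-- The data memory after the tables have been written: the table list at `TU`, the relocated
input elsewhere. [folklore] -/
def tabMem (a : ℕ) : ℕ :=
  if g.TU ≤ a ∧ a < g.TU + g.tb.tsz then g.tb.tableList.getD (a - g.TU) 0 else relocated g.x a

/-- Table entries. [folklore] -/
theorem tabMem_TU_add {p : ℕ} (hp : p < g.tb.tsz) : g.tabMem (g.TU + p) = g.tb.tableList.getD p 0 := by
  unfold tabMem; rw [if_pos ⟨by omega, by omega⟩, Nat.add_sub_cancel_left]

/-- Below the tables the data is the relocated input. [folklore] -/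
theorem tabMem_of_lt_TU {a : ℕ} (ha : a < g.TU) : g.tabMem a = relocated g.x a := by
  unfold tabMem; rw [if_neg (by omega)]

/-- From `BA` on the data is `0` after the tables. [folklore] -/
theorem tabMem_of_BA_le {a : ℕ} (ha : g.BA ≤ a) : g.tabMem a = 0 := by
  have := g.BA_eq
  unfold tabMem; rw [if_neg (by omega), g.relocated_of_TU_le (by have := g.bases; omega)]

/-- **The tables.** From the base registers and the relocated data, `tables` writes the four
constant tables: the data becomes `tabMem`; registers other than `20` are kept. [folklore] -/
theorem tables_spec (hF : g.Fits W) (htb : g.tb.WF) {m : ℕ → ℕ} (hR : g.Regs m)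
    (hD : ∀ a, 100 ≤ a → m a = relocated g.x a) :
    Achieves W O (tables g.tb) m
      (fun m' => g.Regs m' ∧ (∀ a, a < 100 → a ≠ 20 → m' a = m a) ∧
        ∀ a, 100 ≤ a → m' a = g.tabMem a) (2 * g.tb.tsz + 1) := by
  obtain ⟨hX, hXL, hTU, hTV, hTC, hTS, hBA, hBB, hKA, hH0, htop, hxx, hdk, hrk, hbd, hprod, hL,
    hP, hnn⟩ := g.facts hF
  have hBA' := g.BA_eq
  have hlen := g.tb.length_tableList
  unfold tables
  refine CliqueRed.achieves_block_of_eq (fun m' hm' => ?_) (by simp [hlen])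
  rw [execOps_cons] at hm'
  have e1 : execOp W (merge m m) (BinOp.band, r 20, r 7, r 7) = merge (Function.update m 20 g.TU) m := by
    simp (disch := first | omega | decide) only [execOp, Operand.write, Operand.read,
      merge_apply_of_lt, update_merge_of_lt, BinOp.eval_band, Nat.and_self, hR.r7]
  rw [e1, execOps_tabOps (W := W) g.tb.tableList (Function.update m 20 g.TU) m g.TU
    (Function.update_self ..) (by omega) (by rw [hlen]; omega)
    (fun v hv => by have := g.tableList_lt htb hv; omega), Function.update_idem] at hm'
  subst hm'
  refine ⟨hR.of_frame fun a ha => ?_, fun a ha ha20 => ?_, fun a ha => ?_⟩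
  · rw [merge_apply_of_lt (by omega), Function.update_of_ne (by omega)]
  · rw [merge_apply_of_lt ha, Function.update_of_ne ha20]
  · rw [merge_apply_of_le ha]
    unfold writeList tabMem
    rw [hlen]
    by_cases h1 : g.TU ≤ a ∧ a < g.TU + g.tb.tsz
    · rw [if_pos h1, if_pos h1]
    · rw [if_neg h1, if_neg h1, hD a ha]


/-! ### The block codes -/

/-- Bits are bits. [folklore] -/
theorem bitA_le (i t : ℕ) : g.bitA i t ≤ 1 := by
  unfold bitA; split_ifs
  · exact Bool.toNat_le _
  · exact Nat.zero_le _

/-- Bits are bits. [folklore] -/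
theorem bitB_le (j t : ℕ) : g.bitB j t ≤ 1 := by
  unfold bitB; split_ifs
  · exact Bool.toNat_le _
  · exact Nat.zero_le _

/-- `d ≤ K k`: the blocks cover the coordinates (for `k ≥ 1`). [folklore] -/
theorem d_le_Kk (hk : 1 ≤ g.tb.k) : g.d ≤ g.K * g.tb.k := by
  unfold K
  have h1 := Nat.div_add_mod (g.d + (g.tb.k - 1)) g.tb.k
  have h2 := Nat.mod_lt (g.d + (g.tb.k - 1)) hk
  rw [Nat.mul_comm]
  omega

/-- The value of cell `idx` of a block-code array after the rows `< i` and `t` bits of row `i`.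
[folklore] -/
def codeVal (code : ℕ → ℕ → ℕ) (bit : ℕ → ℕ → ℕ) (i t idx : ℕ) : ℕ :=
  if idx / g.K < i then code (idx / g.K) (idx % g.K)
  else if idx / g.K = i then partCode (bit i) g.tb.k t (idx % g.K) else 0

/-- The data memory during the block-code phase. [folklore] -/
def codeData (i t : ℕ) (a : ℕ) : ℕ :=
  if g.BA ≤ a ∧ a < g.BA + g.n * g.K then g.codeVal g.codeA g.bitA i t (a - g.BA)
  else if g.BB ≤ a ∧ a < g.BB + g.n * g.K then g.codeVal g.codeB g.bitB i t (a - g.BB)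
  else g.tabMem a

/-- The data memory after the block codes. [folklore] -/
def codeMem (a : ℕ) : ℕ := g.codeData g.n 0 a

/-- Stage `(0, 0)` is the table memory. [folklore] -/
theorem codeData_zero (a : ℕ) : g.codeData 0 0 a = g.tabMem a := by
  unfold codeData codeVal
  have hz : ∀ bit : ℕ → ℕ → ℕ, partCode (bit 0) g.tb.k 0 = fun _ => 0 := fun bit => by
    funext mb; exact partCode_zero _ _ _
  by_cases h1 : g.BA ≤ a ∧ a < g.BA + g.n * g.K
  · rw [if_pos h1, g.tabMem_of_BA_le h1.1]; simp [hz]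
  rw [if_neg h1]
  by_cases h2 : g.BB ≤ a ∧ a < g.BB + g.n * g.K
  · rw [if_pos h2, g.tabMem_of_BA_le (by have := g.bases; omega)]; simp [hz]
  rw [if_neg h2]

/-- A finished row: stage `(i, d)` is stage `(i + 1, 0)`. [folklore] -/
theorem codeData_row (i a : ℕ) : g.codeData i g.d a = g.codeData (i + 1) 0 a := by
  have hv : ∀ (code : ℕ → ℕ → ℕ) (bit : ℕ → ℕ → ℕ) (idx : ℕ),
      (∀ i mb, code i mb = partCode (bit i) g.tb.k g.d mb) →
      g.codeVal code bit i g.d idx = g.codeVal code bit (i + 1) 0 idx := by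
    intro code bit idx hc
    unfold codeVal
    by_cases h1 : idx / g.K < i
    · rw [if_pos h1, if_pos (by omega)]
    rw [if_neg h1]
    by_cases h2 : idx / g.K = i
    · rw [if_pos h2, if_pos (by omega), hc, h2]
    rw [if_neg h2, if_neg (by omega)]
    by_cases h3 : idx / g.K = i + 1
    · rw [if_pos h3, partCode_zero]
    rw [if_neg h3]
  unfold codeData
  rw [hv g.codeA g.bitA _ (fun _ _ => rfl), hv g.codeB g.bitB _ (fun _ _ => rfl)]

/-- Outside the code arrays the data is the table memory. [folklore] -/
theorem codeData_of_lt_BA (i t : ℕ) {a : ℕ} (ha : a < g.BA) : g.codeData i t a = g.tabMem a := by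
  unfold codeData; rw [if_neg (by omega), if_neg (by have := g.bases; omega)]

/-- **One bit written** in both code arrays turns stage `(i, t)` into stage `(i, t + 1)`.
[folklore] -/
theorem codeData_succ (hk : 1 ≤ g.tb.k) {i t : ℕ} (hi : i < g.n) (ht : t < g.d) {m : ℕ → ℕ}
    (hm : ∀ a, 100 ≤ a → m a = g.codeData i t a) (a : ℕ) (ha : 100 ≤ a) :
    Function.update (Function.update m (g.BA + i * g.K + t / g.tb.k)
        (partCode (g.bitA i) g.tb.k t (t / g.tb.k) + g.bitA i t * 2 ^ (t % g.tb.k)))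
      (g.BB + i * g.K + t / g.tb.k)
        (partCode (g.bitB i) g.tb.k t (t / g.tb.k) + g.bitB i t * 2 ^ (t % g.tb.k)) a =
      g.codeData i (t + 1) a := by
  obtain ⟨hX, hTU, hTV, hTC, hTS, hBA, hBB, hKA, hH0⟩ := g.bases
  have hKk := g.d_le_Kk hk
  have hK : 0 < g.K := by
    rcases Nat.eq_zero_or_pos g.K with h0 | h; · rw [h0] at hKk; omega
    · exact h
  have hmb : t / g.tb.k < g.K := Nat.div_lt_of_lt_mul (by rw [Nat.mul_comm]; omega)
  have hidx : i * g.K + t / g.tb.k < g.n * g.K := by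
    calc i * g.K + t / g.tb.k < i * g.K + g.K := by omega
      _ = (i + 1) * g.K := by ring
      _ ≤ g.n * g.K := Nat.mul_le_mul_right _ hi
  have hdiv : (i * g.K + t / g.tb.k) / g.K = i := by
    rw [Nat.add_comm, Nat.add_mul_div_right _ _ hK, Nat.div_eq_of_lt hmb, Nat.zero_add]
  have hmod : (i * g.K + t / g.tb.k) % g.K = t / g.tb.k := by
    rw [Nat.add_comm, Nat.add_mul_mod_self_right, Nat.mod_eq_of_lt hmb]
  -- the generic step of one array
  have step : ∀ (code : ℕ → ℕ → ℕ) (bit : ℕ → ℕ → ℕ) (idx : ℕ),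
      g.codeVal code bit i (t + 1) idx =
        if idx = i * g.K + t / g.tb.k then partCode (bit i) g.tb.k t (t / g.tb.k) + bit i t * 2 ^ (t % g.tb.k)
        else g.codeVal code bit i t idx := by
    intro code bit idx
    by_cases he : idx = i * g.K + t / g.tb.k
    · rw [if_pos he]; unfold codeVal
      rw [he, hdiv, hmod, if_neg (lt_irrefl _), if_pos rfl, partCode_succ, if_pos rfl]
    rw [if_neg he]; unfold codeVal
    by_cases h1 : idx / g.K < i
    · rw [if_pos h1, if_pos h1]
    rw [if_neg h1, if_neg h1]
    by_cases h2 : idx / g.K = i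
    · rw [if_pos h2, if_pos h2, partCode_succ]
      have hne : t / g.tb.k ≠ idx % g.K := by
        intro h'; apply he
        rw [← Nat.div_add_mod idx g.K, h2, ← h']; ring
      rw [if_neg hne, Nat.add_zero]
    rw [if_neg h2, if_neg h2]
  by_cases hb : a = g.BB + i * g.K + t / g.tb.k
  · subst hb; rw [Function.update_self]; unfold codeData
    rw [if_neg (by omega), if_pos ⟨by omega, by omega⟩, step,
      if_pos (by omega)]
  rw [Function.update_of_ne hb]
  by_cases hc : a = g.BA + i * g.K + t / g.tb.k
  · subst hc; rw [Function.update_self]; unfold codeData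
    rw [if_pos ⟨by omega, by omega⟩, step, if_pos (by omega)]
  rw [Function.update_of_ne hc, hm a ha]
  unfold codeData
  by_cases h1 : g.BA ≤ a ∧ a < g.BA + g.n * g.K
  · rw [if_pos h1, if_pos h1, step, if_neg (by omega)]
  rw [if_neg h1, if_neg h1]
  by_cases h2 : g.BB ≤ a ∧ a < g.BB + g.n * g.K
  · rw [if_pos h2, if_pos h2, step, if_neg (by omega)]
  rw [if_neg h2, if_neg h2]


/-! ### The block-code loops -/

/-- The invariant of the bit loop of row `i` after `t` bits (registers below `20` frozen at `m₀`).
[folklore] -/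
structure CodesIn (m₀ : ℕ → ℕ) (i t : ℕ) (m : ℕ → ℕ) : Prop where
  low : ∀ a, a < 20 → m a = m₀ a
  r20 : m 20 = g.n - i
  r21 : m 21 = i
  r22 : m 22 = g.X + 2 + i * g.d + t
  r23 : m 23 = g.X + 2 + g.n * g.d + i * g.d + t
  r24 : m 24 = g.BA + i * g.K
  r25 : m 25 = g.BB + i * g.K
  r26 : m 26 = g.d - t
  r27 : m 27 = t
  data : ∀ a, 100 ≤ a → m a = g.codeData i t a

/-- The invariant of the row loop after `i` rows. [folklore] -/
structure CodesOut (m₀ : ℕ → ℕ) (i : ℕ) (m : ℕ → ℕ) : Prop where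
  low : ∀ a, a < 20 → m a = m₀ a
  r20 : m 20 = g.n - i
  r21 : m 21 = i
  r22 : m 22 = g.X + 2 + i * g.d
  r23 : m 23 = g.X + 2 + g.n * g.d + i * g.d
  r24 : m 24 = g.BA + i * g.K
  r25 : m 25 = g.BB + i * g.K
  data : ∀ a, 100 ≤ a → m a = g.codeData i 0 a

set_option maxHeartbeats 1000000 in
/-- **The bit loop of row `i`.** [folklore] -/
theorem codesBit_loop (hF : g.Fits W) (hk : 1 ≤ g.tb.k) {m₀ : ℕ → ℕ} {i : ℕ}
    (hi : i < g.n) {m : ℕ → ℕ} (h0 : g.CodesIn m₀ i 0 m) :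
    Achieves W O (whilenz (r 26) (codesBit g.tb)) m (g.CodesIn m₀ i g.d) (g.d * 16 + 1) := by
  obtain ⟨hX, hXL, hTU, hTV, hTC, hTS, hBA, hBB, hKA, hH0, htop, hxx, hdk, hrk, hbd, hprod, hL,
    hP, hnn⟩ := g.facts hF
  have hKk := g.d_le_Kk hk
  have hnd : (i + 1) * g.d ≤ g.n * g.d := Nat.mul_le_mul_right _ hi
  have hnK : (i + 1) * g.K ≤ g.n * g.K := Nat.mul_le_mul_right _ hi
  have hPk : 2 ^ g.tb.k = g.tb.P := rfl
  refine Achieves.whilenz g.d 14 (fun t => g.CodesIn m₀ i t) (fun t ht m' hI => ⟨?_, ?_⟩)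
    (fun m' hI => ?_) h0 (fun _ h => h) (by omega)
  · simp only [Operand.read, hI.r26]; omega
  · obtain ⟨hlow, r20, r21, r22, r23, r24, r25, r26, r27, hD⟩ := hI
    -- name the quotient and remainder (omega does not know `↑t / ↑k ≥ 0`)
    obtain ⟨mb, hdiv⟩ : ∃ mb, t / g.tb.k = mb := ⟨_, rfl⟩
    obtain ⟨e, hmod⟩ : ∃ e, t % g.tb.k = e := ⟨_, rfl⟩
    have hmb : mb < g.K := by
      rw [← hdiv]; exact Nat.div_lt_of_lt_mul (by rw [Nat.mul_comm]; omega)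
    have hK : 0 < g.K := by omega
    have hidx : i * g.K + mb < g.n * g.K := by
      have : (i + 1) * g.K = i * g.K + g.K := by ring
      omega
    have hid : i * g.d + t < g.n * g.d := by
      have : (i + 1) * g.d = i * g.d + g.d := by ring
      omega
    have he : 2 ^ e < g.tb.P := by
      rw [← hPk, ← hmod]; exact Nat.pow_lt_pow_right (by norm_num) (Nat.mod_lt _ hk)
    have hbA := g.bitA_le i t
    have hbB := g.bitB_le i t
    have hshA : g.bitA i t * 2 ^ e < 2 ^ W := by
      calc _ ≤ 1 * 2 ^ e := Nat.mul_le_mul_right _ hbA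
        _ < 2 ^ W := by omega
    have hshB : g.bitB i t * 2 ^ e < 2 ^ W := by
      calc _ ≤ 1 * 2 ^ e := Nat.mul_le_mul_right _ hbB
        _ < 2 ^ W := by omega
    have hcA : partCode (g.bitA i) g.tb.k t mb + g.bitA i t * 2 ^ e < 2 ^ W := by
      have := partCode_lt (g.bitA_le i) hk (t + 1) mb
      rw [partCode_succ, hdiv, hmod, if_pos rfl] at this
      have hPW : g.tb.P ≤ 2 ^ W := by omega
      exact lt_of_lt_of_le this (hPk ▸ hPW)
    have hcB : partCode (g.bitB i) g.tb.k t mb + g.bitB i t * 2 ^ e < 2 ^ W := by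
      have := partCode_lt (g.bitB_le i) hk (t + 1) mb
      rw [partCode_succ, hdiv, hmod, if_pos rfl] at this
      have hPW : g.tb.P ≤ 2 ^ W := by omega
      exact lt_of_lt_of_le this (hPk ▸ hPW)
    -- the reads
    have hrA : m' (g.X + 2 + i * g.d + t) = g.bitA i t := by
      rw [hD (g.X + 2 + i * g.d + t) (by omega), g.codeData_of_lt_BA _ _ (show g.X + 2 + i * g.d + t < g.BA by omega),
        g.tabMem_of_lt_TU (show g.X + 2 + i * g.d + t < g.TU by omega),
        show g.X + 2 + i * g.d + t = g.X + (2 + (i * g.d + t)) by omega, g.relocated_X_add,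
        g.x_getD_A hi ht]
    have hrB : m' (g.X + 2 + g.n * g.d + i * g.d + t) = g.bitB i t := by
      rw [hD (g.X + 2 + g.n * g.d + i * g.d + t) (by omega),
        g.codeData_of_lt_BA _ _ (show g.X + 2 + g.n * g.d + i * g.d + t < g.BA by omega),
        g.tabMem_of_lt_TU (show g.X + 2 + g.n * g.d + i * g.d + t < g.TU by omega),
        show g.X + 2 + g.n * g.d + i * g.d + t = g.X + (2 + (g.n * g.d + (i * g.d + t))) by omega,
        g.relocated_X_add, g.x_getD_B hi ht]
    have hpA : m' (g.BA + i * g.K + mb) = partCode (g.bitA i) g.tb.k t mb := by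
      rw [hD (g.BA + i * g.K + mb) (by omega)]; unfold codeData
      rw [if_pos ⟨by omega, by omega⟩, show g.BA + i * g.K + mb - g.BA = i * g.K + mb by omega]
      unfold codeVal
      rw [Nat.add_comm, Nat.add_mul_div_right _ _ hK, Nat.div_eq_of_lt hmb, Nat.zero_add,
        if_neg (lt_irrefl _), if_pos rfl, Nat.add_mul_mod_self_right, Nat.mod_eq_of_lt hmb]
    have hpB : m' (g.BB + i * g.K + mb) = partCode (g.bitB i) g.tb.k t mb := by
      rw [hD (g.BB + i * g.K + mb) (by omega)]; unfold codeData
      rw [if_neg (by omega), if_pos ⟨by omega, by omega⟩,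
        show g.BB + i * g.K + mb - g.BB = i * g.K + mb by omega]
      unfold codeVal
      rw [Nat.add_comm, Nat.add_mul_div_right _ _ hK, Nat.div_eq_of_lt hmb, Nat.zero_add,
        if_neg (lt_irrefl _), if_pos rfl, Nat.add_mul_mod_self_right, Nat.mod_eq_of_lt hmb]
    have hne : g.BA + i * g.K + mb ≠ g.BB + i * g.K + mb := by omega
    have hstep := g.codeData_succ hk hi ht hD
    rw [hdiv, hmod] at hstep
    refine CliqueRed.achieves_block_of_eq (fun m'' hm'' => ?_) le_rfl
    simp (disch := first | omega | decide) only [execOps_cons, execOps_nil, execOp,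
      Operand.write, Operand.read, merge_apply_of_lt, merge_apply_of_le, update_merge_of_lt,
      update_merge_of_le, Function.update_self, Function.update_of_ne, BinOp.eval_add_of_lt,
      BinOp.eval_sub_of_le, BinOp.eval_div, BinOp.eval_mod, BinOp.eval_band, BinOp.eval_shl_of_lt,
      Nat.and_self, r22, r23, r24, r25, r26, r27, hdiv, hmod, hrA, hrB, hpA, hpB] at hm''
    subst hm''
    refine ⟨fun a ha => ?low, ?_, ?_, ?_, ?_, ?_, ?_, ?_, ?_, fun a ha => ?data⟩
    case low =>
      rw [merge_apply_of_lt (by omega)]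
      simp (disch := omega) only [Function.update_of_ne]
      exact hlow a ha
    case data =>
      rw [merge_apply_of_le ha]
      exact hstep a ha
    all_goals (try simp (disch := first | omega | decide) only [merge_apply_of_lt,
      Function.update_self, Function.update_of_ne])
    all_goals first | assumption | omega
  · simp only [Operand.read, hI.r26]; omega


/-- **One row of block codes.** [folklore] -/
theorem codesRow_spec (hF : g.Fits W) (hk : 1 ≤ g.tb.k) {m₀ : ℕ → ℕ} (hR : g.Regs m₀) {i : ℕ}
    (hi : i < g.n) {m : ℕ → ℕ} (h0 : g.CodesOut m₀ i m) :
    Achieves W O (codesRow g.tb) m (g.CodesOut m₀ (i + 1)) (g.d * 16 + 7) := by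
  obtain ⟨hX, hXL, hTU, hTV, hTC, hTS, hBA, hBB, hKA, hH0, htop, hxx, hdk, hrk, hbd, hprod, hL,
    hP, hnn⟩ := g.facts hF
  have hKd := g.K_le_d hk
  have hnK : (i + 1) * g.K ≤ g.n * g.K := Nat.mul_le_mul_right _ hi
  have hnd : (i + 1) * g.d ≤ g.n * g.d := Nat.mul_le_mul_right _ hi
  have hiK : (i + 1) * g.K = i * g.K + g.K := by ring
  have hid : (i + 1) * g.d = i * g.d + g.d := by ring
  obtain ⟨hlow, r20, r21, r22, r23, r24, r25, hD⟩ := h0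
  have r3 : m 3 = g.d := by rw [hlow 3 (by omega), hR.r3]
  unfold codesRow
  refine Achieves.mono (T := 2 + (g.d * 16 + 1 + 4)) ?_ (fun _ h => h) (by omega)
  refine Achieves.seqs_cons (R := g.CodesIn m₀ i 0) (T₁ := 2) (T₂ := g.d * 16 + 1 + 4) ?_
    fun m₁ h₁ => ?_
  · refine CliqueRed.achieves_block_of_eq (fun m' hm' => ?_) le_rfl
    simp (disch := first | omega | decide) only [execOps_cons, execOps_nil, execOp, Operand.write,
      Operand.read, merge_apply_of_lt, update_merge_of_lt, BinOp.eval_band, Nat.and_self,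
      r3] at hm'
    subst hm'
    refine ⟨fun a ha => ?low, ?_, ?_, ?_, ?_, ?_, ?_, ?_, ?_, fun a ha => ?data⟩
    case low =>
      rw [merge_apply_of_lt (by omega)]
      simp (disch := omega) only [Function.update_of_ne]
      exact hlow a ha
    case data => rw [merge_apply_of_le ha]; exact hD a ha
    all_goals (try simp (disch := first | omega | decide) only [merge_apply_of_lt,
      Function.update_self, Function.update_of_ne])
    all_goals first | assumption | omega
  refine Achieves.seqs_cons (R := g.CodesIn m₀ i g.d) (T₁ := g.d * 16 + 1) (T₂ := 4)
    (g.codesBit_loop hF hk hi h₁) fun m₂ h₂ => ?_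
  obtain ⟨hlow2, s20, s21, s22, s23, s24, s25, s26, s27, sD⟩ := h₂
  have s4 : m₂ 4 = g.K := by rw [hlow2 4 (by omega), hR.r4]
  refine Achieves.seqs_cons (T₁ := 4) (T₂ := 0) ?_ (fun _ h => Achieves.seqs_nil h)
  refine CliqueRed.achieves_block_of_eq (fun m' hm' => ?_) le_rfl
  simp (disch := first | omega | decide) only [execOps_cons, execOps_nil, execOp, Operand.write,
    Operand.read, merge_apply_of_lt, update_merge_of_lt, Function.update_of_ne,
    BinOp.eval_add_of_lt, BinOp.eval_sub_of_le, s20, s21, s24, s25, s4] at hm'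
  subst hm'
  refine ⟨fun a ha => ?low2, ?_, ?_, ?_, ?_, ?_, ?_, fun a ha => ?data2⟩
  case low2 =>
    rw [merge_apply_of_lt (by omega)]
    simp (disch := omega) only [Function.update_of_ne]
    exact hlow2 a ha
  case data2 => rw [merge_apply_of_le ha, sD a ha, g.codeData_row]
  all_goals (try simp (disch := first | omega | decide) only [merge_apply_of_lt,
    Function.update_self, Function.update_of_ne])
  all_goals first | assumption | omega

/-- **The block codes.** From the base registers and the table memory, `codes` computes the block
codes of all rows of both lists: the data becomes `codeMem`; registers below `20` are kept.
[folklore] -/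
theorem codes_spec (hF : g.Fits W) (hk : 1 ≤ g.tb.k) {m : ℕ → ℕ} (hR : g.Regs m)
    (hD : ∀ a, 100 ≤ a → m a = g.tabMem a) :
    Achieves W O (codes g.tb) m
      (fun m' => (∀ a, a < 20 → m' a = m a) ∧ ∀ a, 100 ≤ a → m' a = g.codeMem a)
      (g.n * (g.d * 16 + 9) + 8) := by
  obtain ⟨hX, hXL, hTU, hTV, hTC, hTS, hBA, hBB, hKA, hH0, htop, hxx, hdk, hrk, hbd, hprod, hL,
    hP, hnn⟩ := g.facts hF
  obtain ⟨r0, r2, r3, r4, r5, r6, r7, r8, r9, r10, r11, r12⟩ := id hR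
  have hnd : g.n * g.d ≤ g.L := by omega
  unfold codes
  refine Achieves.mono (T := 7 + (g.n * (g.d * 16 + 9) + 1)) ?_ (fun _ h => h) (by omega)
  refine Achieves.seqs_cons (R := g.CodesOut m 0) (T₁ := 7) (T₂ := g.n * (g.d * 16 + 9) + 1) ?_
    fun m₁ h₁ => ?_
  · refine CliqueRed.achieves_block_of_eq (fun m' hm' => ?_) le_rfl
    simp (disch := first | omega | decide) only [execOps_cons, execOps_nil, execOp, Operand.write,
      Operand.read, merge_apply_of_lt, update_merge_of_lt, Function.update_of_ne,
      Function.update_self, BinOp.eval_band, BinOp.eval_add_of_lt, BinOp.eval_mul_of_lt,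
      Nat.and_self, r0, r2, r3, r5, r6] at hm'
    subst hm'
    refine ⟨fun a ha => ?low, ?_, ?_, ?_, ?_, ?_, ?_, fun a ha => ?data⟩
    case low =>
      rw [merge_apply_of_lt (by omega)]
      simp (disch := omega) only [Function.update_of_ne]
    case data => rw [merge_apply_of_le ha, g.codeData_zero]; exact hD a ha
    all_goals (try simp (disch := first | omega | decide) only [merge_apply_of_lt,
      Function.update_self, Function.update_of_ne])
    all_goals omega
  refine Achieves.seqs_cons (T₁ := g.n * (g.d * 16 + 9) + 1) (T₂ := 0) ?_
    (fun _ h => Achieves.seqs_nil h)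
  refine Achieves.whilenz g.n (g.d * 16 + 7) (fun i => g.CodesOut m i) (fun i hi m' hI => ⟨?_, ?_⟩)
    (fun m' hI => ?_) h₁ (fun m' hI => ⟨hI.low, fun a ha => ?_⟩)
    (by rw [show g.d * 16 + 7 + 2 = g.d * 16 + 9 from rfl])
  · simp only [Operand.read, hI.r20]; omega
  · exact g.codesRow_spec hF hk hR hi hI
  · simp only [Operand.read, hI.r20]; omega
  · rw [hI.data a ha]; rfl


end Params

end OVEq

end Literature.Computability.FineGrained
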